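import Summits.BirchSwinnertonDyer.BirchSwinnertonDyer.Theorems.ManinLocalTwoThreeAdditiveDyadicTransport
import Summits.BirchSwinnertonDyer.Rank1Residual.ManinAdditive.TwistOrbitManinTransportProof
import HarnessLib

/-!
# Route `ManinLocalTwoThree` (cell `bsd-f2-manin`), cruxes C2/C3: transport of `p ∤ c` UP an ALIGNED odd
# twist `W ∼ A ⊗ ℚ(√q*)` (any levels `N(A) ∣ N`, `q² ∣ N`) and the `|Δ_min|` bookkeeping of aligned twists

The cell's THEOREM A at `(q*, q, q²)` (`TwistOrbitManinTransport`, an T-an-6, kernel-checked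
`twistOrbitManinTransport_pStar`) is stated for SAME-conductor data at the conductor levels literally. For the
twist-orbit-minimal reductions of C2/C3 we need its clause 1 (`ũ = 1`: `Δ(C) = (q*)⁶ Δ(A) ⟹ c(D_W) ∣ c(D_A)`)
at arbitrary levels `N' ∣ N` of the data (the level of a datum is the conductor only modulo modularity), with
the target `W` additive at `q`. §1 re-assembles it from the same tree pieces (`cuspCoeff_eq_chi_mul_of_twist_pStar`,
`neronLattice_mem_iff_of_twist_pStar`, `maninConstant_dvd_of_charTwist_gamma0`). §2: if `Δ(C) = d⁶ Δ(A)` with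
`|d| ≥ 2` then `|Δ_min(A)| < |Δ_min(C)|` — the measure that makes «transport from the aligned partner» a
well-founded reduction (used with `d = ±2` in `ManinLocalTwoThreeManinOddAtFourDyadicLevelMinimal`, here for
every `d`). Census motivating it (cell table TWISTCENSUS2, same-level `χ_{q*}` pairs of optimal curves with
`q² ∣ N ≤ 5·10⁵`): commuting pairs are aligned in EXACTLY one direction (`q = 3`: 141 916 + 141 916;
`q = 5`: 81 755 + 81 755; `q = 7`: 46 852 + 46 852; …), flips in both. Nothing here proves BSD or Manin's
conjecture. Seat bsd-line-manin23-p2 (gen 2).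

References: [Stevens1989] Lemmas (5.2), (5.4); [Pal2012] Lemma 3.1; [SilvermanATAEC1994] Cor. IV.9.1.
-/

set_option autoImplicit false
set_option linter.dupNamespace false

noncomputable section

open scoped MatrixGroups ModularForm Classical NumberField

namespace Summit.BirchSwinnertonDyer.BirchSwinnertonDyer.Theorems

open CongruenceSubgroup WeierstrassCurve IsDedekindDomain IsDedekindDomain.HeightOneSpectrum
  Rat.HeightOneSpectrum Literature.NumberTheory.Automorphic
  Literature.NumberTheory.EllipticCurves Literature.NumberTheory.EllipticCurves.ModularForms
  Summit.BirchSwinnertonDyer.Rank1Residual.ManinAdditive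

/-! ## §1 `c(D) ∣ c(D')` up an aligned `χ_{q*}`-twist, generic levels -/

/-- **Exact divisibility `c(D) ∣ c(D')` along an ALIGNED `χ_{q*}`-twist** (`q` an odd prime). `W` globally
minimal with a lattice-optimal `X₀(N)`-datum `D`, additive at `q`, `q² ∣ N`; `A` any elliptic curve with ANY
`X₀(N')`-datum `D'`, `N' ∣ N`; `C = u • (A ⊗ ℚ(√q*))` globally minimal, isogenous to `W`, with
`Δ(C) = (q*)⁶ Δ(A)` (ALIGNED, `ũ = 1`). Then `c(D) ∣ c(D')`. This is clause 1 of the cell's THEOREM A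
(`twistOrbitManinTransport_pStar`) with the conductor-level bookkeeping removed: `f_D = f_{D'} ⊗ χ_q`
(`cuspCoeff_eq_chi_mul_of_twist_pStar`), `Λ_C = g(χ_q)⁻¹ Λ_A` (`neronLattice_mem_iff_of_twist_pStar`, `r = 1`),
and the `Γ₀` twist step `maninConstant_dvd_of_charTwist_gamma0`.
[cite: Stevens1989, Lemmas (5.2), (5.4)] [cite: Pal2012, Lemma 3.1] [cite: SilvermanATAEC1994, Cor. IV.9.1] -/
theorem maninLocalTwoThree_maninConstant_dvd_of_twist_pStar_aligned
    {q : ℕ} [Fact q.Prime] (hq2 : q ≠ 2)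
    {W : WeierstrassCurve ℚ} [W.IsElliptic] [W.IsGloballyMinimal] {N : ℕ} [NeZero N]
    (D : ModularParametrizationData W N)
    (hopt : ∀ z ∈ D.L.lattice, ∃ w ∈ periodLattice D.f, z = D.c * w)
    {A : WeierstrassCurve ℚ} [A.IsElliptic] {N' : ℕ} [NeZero N'] (D' : ModularParametrizationData A N')
    (hN'N : N' ∣ N) (hqN : q ^ 2 ∣ N)
    (hadd : ¬ W.HasGoodReductionAtPrime q ∧ ¬ W.HasMultiplicativeReductionAtPrime q)
    {C : WeierstrassCurve ℚ} [C.IsElliptic] [C.IsGloballyMinimal] (u : VariableChange ℚ)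
    (hu : u • A.quadraticTwist (((-1 : ℤ) ^ (q / 2) * q : ℤ) : ℚ) = C) (hCW : IsIsogenous C W)
    (hΔ : C.Δ = ((((-1 : ℤ) ^ (q / 2) * q : ℤ)) : ℚ) ^ 6 * A.Δ) :
    D.c ∣ D'.c := by
  have hq : q.Prime := Fact.out
  haveI : NeZero q := ⟨hq.ne_zero⟩
  have hW0 : ∀ n : ℕ, q ∣ n → W.LFunction n = 0 := fun n hn ↦
    W.LFunction_apply_eq_zero_of_not_good_of_not_mult q hadd.1 hadd.2 hn
  -- `aₙ(f_D) = χ_q(n) aₙ(f_{D'})`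
  have hcoef : ∀ n : ℕ, cuspCoeff D.f n =
      (quadraticChar (ZMod q)).ringHomComp (Int.castRingHom ℂ) n * cuspCoeff D'.f n := fun n ↦
    cuspCoeff_eq_chi_mul_of_twist_pStar hq2 u hu (LFunction_eq_of_isIsogenous_holds _ _ hCW) hW0 D' D n
  -- `Λ_C = g(χ_q)⁻¹ Λ_A`
  obtain ⟨LC, hLC⟩ := exists_isNeronLatticeOf_holds (C.baseChange ℂ)
  have hΔ1 : (1 : ℚ) ^ 12 * C.Δ = ((((-1 : ℤ) ^ (q / 2) * q : ℤ)) : ℚ) ^ 6 * A.Δ := by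
    rw [one_pow, one_mul]; exact hΔ
  have hmem : ∀ z : ℂ, z ∈ LC.lattice ↔
      gaussSum ((quadraticChar (ZMod q)).ringHomComp (Int.castRingHom ℂ)) (ZMod.stdAddChar (N := q)) * z ∈
        D'.L.lattice := fun z ↦ by
    simpa using neronLattice_mem_iff_of_twist_pStar hq2 u hu hΔ1 D'.isNeronLattice hLC z
  have hqN' : q ^ 2 ∣ N := hqN
  exact maninConstant_dvd_of_charTwist_gamma0 D' D hopt (isQuadratic_quadraticChar_ringHomComp q)
    (isPrimitive_quadraticChar_ringHomComp q hq2) hN'N hqN' hcoef hLC hmem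

/-- **Transport of `p ∤ c` UP an aligned `χ_{q*}`-twist** (any prime `p`): in the situation of
`maninLocalTwoThree_maninConstant_dvd_of_twist_pStar_aligned`, `p ∤ c(D')` implies `p ∤ c(D)`.
[cite: Stevens1989, Lemmas (5.2), (5.4)] [cite: Pal2012, Lemma 3.1] -/
theorem maninLocalTwoThree_not_dvd_maninConstant_of_untwist_pStar_aligned
    {q : ℕ} [Fact q.Prime] (hq2 : q ≠ 2)
    {W : WeierstrassCurve ℚ} [W.IsElliptic] [W.IsGloballyMinimal] {N : ℕ} [NeZero N]
    (D : ModularParametrizationData W N)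
    (hopt : ∀ z ∈ D.L.lattice, ∃ w ∈ periodLattice D.f, z = D.c * w)
    {A : WeierstrassCurve ℚ} [A.IsElliptic] {N' : ℕ} [NeZero N'] (D' : ModularParametrizationData A N')
    (hN'N : N' ∣ N) (hqN : q ^ 2 ∣ N)
    (hadd : ¬ W.HasGoodReductionAtPrime q ∧ ¬ W.HasMultiplicativeReductionAtPrime q)
    {C : WeierstrassCurve ℚ} [C.IsElliptic] [C.IsGloballyMinimal] (u : VariableChange ℚ)
    (hu : u • A.quadraticTwist (((-1 : ℤ) ^ (q / 2) * q : ℤ) : ℚ) = C) (hCW : IsIsogenous C W)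
    (hΔ : C.Δ = ((((-1 : ℤ) ^ (q / 2) * q : ℤ)) : ℚ) ^ 6 * A.Δ) {p : ℤ}
    (hp : ¬ p ∣ D'.maninConstant) : ¬ p ∣ D.maninConstant :=
  fun h ↦ hp (h.trans (maninLocalTwoThree_maninConstant_dvd_of_twist_pStar_aligned hq2 D hopt D' hN'N
    hqN hadd u hu hCW hΔ))

/-! ## §2 `|Δ_min|` strictly increases along an aligned twist -/

/-- **Aligned twists raise `|Δ_min|`.** If `Δ(C) = d⁶ Δ(A)` for globally minimal `A`, `C` and an integer `d`
with `d ≠ 0, ±1`, then `|Δ_min(A)| < |Δ_min(C)|` (as integers `Δ_min(C) = d⁶ Δ_min(A)`, `|d⁶| ≥ 64`,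
`Δ_min(A) ≠ 0`). In particular a COMMUTING aligned partner (`C = W`) always satisfies the `|Δ|` clause of
the twist-orbit-minimal reductions. [elementary] -/
theorem maninLocalTwoThree_natAbs_minimalDiscriminantInt_lt_of_Δ_eq_pow_six {d : ℤ} (hd : 2 ≤ d.natAbs)
    {A C : WeierstrassCurve ℚ} [A.IsElliptic] [A.IsGloballyMinimal] [C.IsElliptic] [C.IsGloballyMinimal]
    (hΔ : C.Δ = (d : ℚ) ^ 6 * A.Δ) :
    A.minimalDiscriminantInt.natAbs < C.minimalDiscriminantInt.natAbs := by
  rw [← cast_minimalDiscriminantInt C, ← cast_minimalDiscriminantInt A] at hΔ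
  have hZ : C.minimalDiscriminantInt = d ^ 6 * A.minimalDiscriminantInt := by exact_mod_cast hΔ
  have hA0 : A.minimalDiscriminantInt ≠ 0 := A.minimalDiscriminantInt_ne_zero
  rw [hZ, Int.natAbs_mul, Int.natAbs_pow]
  have hpos : 0 < A.minimalDiscriminantInt.natAbs := Int.natAbs_pos.mpr hA0
  have h64 : 64 ≤ d.natAbs ^ 6 := by
    calc (64 : ℕ) = 2 ^ 6 := by norm_num
      _ ≤ d.natAbs ^ 6 := Nat.pow_le_pow_left hd 6
  nlinarith

/-- The `q*` instance: `Δ(C) = (q*)⁶ Δ(A)` with `q` prime ⟹ `|Δ_min(A)| < |Δ_min(C)|`. [elementary] -/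
theorem maninLocalTwoThree_natAbs_minimalDiscriminantInt_lt_of_Δ_eq_pStar {q : ℕ} (hq : q.Prime)
    {A C : WeierstrassCurve ℚ} [A.IsElliptic] [A.IsGloballyMinimal] [C.IsElliptic] [C.IsGloballyMinimal]
    (hΔ : C.Δ = ((((-1 : ℤ) ^ (q / 2) * q : ℤ)) : ℚ) ^ 6 * A.Δ) :
    A.minimalDiscriminantInt.natAbs < C.minimalDiscriminantInt.natAbs := by
  refine maninLocalTwoThree_natAbs_minimalDiscriminantInt_lt_of_Δ_eq_pow_six (d := (-1 : ℤ) ^ (q / 2) * q)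
    ?_ hΔ
  rw [Int.natAbs_mul, Int.natAbs_pow]
  simp only [Int.natAbs_neg, Int.natAbs_one, one_pow, one_mul, Int.natAbs_natCast]
  exact hq.two_le

end Summit.BirchSwinnertonDyer.BirchSwinnertonDyer.Theorems

end
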